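import Literature.NumberTheory.Automorphic.BianchiOrdinaryClassicality
import Literature.NumberTheory.EllipticCurves.NewformGaloisRepPadicAlgClProofs
import HarnessLib

/-!
# The parallel-weight coefficients `⨂_τ V_wt` as a representation of `GL_n(𝔸_F^∞)` ("all of `𝒢`
# acts on the coefficients after `⊗ ℚ̄_p`")

Topic `NumberTheory/Automorphic`; namespaces `Literature.NumberTheory.Automorphic.ParallelWeight`
(the grouping namespace of `BianchiOrdinaryClassicality`) and `…TwistedQuotient` (one generic
adapter).  Definitions with bodies and theorems; no named fact, no instance, no `sorry`.

The rational coefficient representation of the fact `hidaControl_dominantOrdinaryPoint` is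
`ParallelWeight.coeffRep E F n wt = ⨂_{τ : F →+* E} V_wt(E) ∘ GL_n(τ)` of `GL_n(F)`
(`BianchiOrdinaryClassicality`).  Hida's comparison between the "coefficients at `∞`" model
(`ParallelWeight.cohomology`, the tree's `TwistedQuotient`) and the "coefficients at `p`" model
(`IntegralWeightHeckeModuleGL2`, `LevelAction.sections`) needs this action to EXTEND to the
finite-adelic group: "after `⊗ ℚ_p` on the coefficients, all of `𝒢` acts" ([Hida1994AIF, §1]: the
map `(g, P) ↦ (g, g_p P)` on `L(n, v; K)`-valued functions; `sectionsEquivLevelFunctions` in the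
tree).  This file constructs the extension:

* `adelicCoeffRep E F n wt v φ` — for place data `v : (F →+* E) → {finite places}` and ring
  homomorphisms `φ τ : F_{v τ} →+* E`, the representation
  `g ↦ ⨂_τ V_wt(GL_n(φ_τ)(g_{v(τ)}))` of `GL_n(𝔸_F^∞)` on `⨂_τ V_wt(E)` (local components
  `localComponent`, then `GL_n(φ_τ)`, then the algebraic representation `coeffRepGL`);
* `adelicCoeffRep_comp_globalEmbedding` — **it restricts to `ParallelWeight.coeffRep` on `GL_n(F)`**
  as soon as `φ_τ ∘ (F → F_{v τ}) = τ` (`localComponent_globalEmbedding`: the `v`-component of a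
  principal element is the matrix mapped along `F → F_v`);
* `exists_placeData_padicAlgCl` — over `E = ℚ̄_p` such data EXIST, with every `v τ` above `p` and
  every `φ_τ` continuous: each `τ : F → ℚ̄_p` cuts out a place `v(τ) ∋ p`
  (`exists_heightOneSpectrum_of_ringHom_padicAlgCl`) and extends continuously to the completion
  (`exists_continuous_ringHom_adicCompletion_padicAlgCl`; Neukirch II §8) — whence the chosen
  `padicPlace`, `padicPlaceHom` and **`padicCoeffRep p F n wt`**, a representation of `GL_n(𝔸_F^∞)` on
  `⨂_{τ : F → ℚ̄_p} V_wt(ℚ̄_p)` with `padicCoeffRep_comp_globalEmbedding :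
  (padicCoeffRep p F n wt) ∘ ι = coeffRep ℚ̄_p F n wt` (`ι = globalEmbedding`), acting at each
  `τ` through the `p`-adic place `padicPlace τ ∣ p` only (`padicCoeffRep_eq_of_localComponent_eq`);
* `TwistedQuotient.coeffRepIsoOfEq`, `heckeRepHom_comp_coeffRepIsoOfEq_hom`,
  `map_coeffRepIsoOfEq_heckeEnd` — the identity-on-functions isomorphism
  `Fun(𝒢 ⧸ U, V)_ρ ≅ Fun(𝒢 ⧸ U, V)_{ρ'}` for `ρ = ρ'` propositionally (e.g. `ρ = σ ∘ ι`,
  `ρ' = coeffRep`), Hecke-compatible, so that comparison isomorphisms stated for `σ ∘ ι` land in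
  `ParallelWeight.cohomology` literally.

## References

* H. Hida, *p-adic ordinary Hecke algebras for GL(2)*, Ann. Inst. Fourier 44 (1994), §1
  (pp. 1292–1294: `L(n, v; A)`, the actions of `G(ℚ)` and of `G(ℚ_p)`) (held). [Hida1994AIF]
* C. Khare, J. A. Thorne, Amer. J. Math. 139 (2017), §6.4 (the `𝒪[GL_n(𝒪_{F,p})]`-module `M_𝛌`,
  `M_𝛌 ⊗_𝒪 E` a `GL_n(F_p)`-module) (arXiv:1409.7007, held). [KhareThorne2017]
* J. Neukirch, *Algebraic Number Theory* (1999), Ch. II §8 (pp. 160–161). [NeukirchANT1999]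
-/

noncomputable section

open CategoryTheory
open scoped NumberField TensorProduct
open IsDedekindDomain

namespace Literature.NumberTheory.Automorphic

/-! ### Changing the twist along a propositional equality `ρ = ρ'` -/

namespace TwistedQuotient

universe u

variable {k : Type u} [CommRing k] {Γ 𝒢 : Type u} [Group Γ] [Group 𝒢] (ι : Γ →* 𝒢)
  (L : Subgroup 𝒢) {V : Type u} [AddCommGroup V] [Module k V] {ρ ρ' : Representation k Γ V}

/-- **`Fun(𝒢 ⧸ L, V)` twisted by `ρ` `≅` twisted by `ρ'` when `ρ = ρ'`** (propositionally): the
identity on functions (no transport along the equality of types is needed downstream). [folklore] -/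
def coeffRepIsoOfEq (h : ρ = ρ') : coeffRep ι L ρ ≅ coeffRep ι L ρ' :=
  Rep.mkIso (Representation.Equiv.mk (LinearEquiv.refl k _) fun γ => by subst h; rfl)

/-- Unfolding lemma: `coeffRepIsoOfEq` is the identity on functions. [folklore] -/
@[simp]
theorem coeffRepIsoOfEq_hom_apply (h : ρ = ρ') (f : (𝒢 ⧸ L) → V) :
    (coeffRepIsoOfEq ι L h).hom f = f :=
  rfl

/-- The Hecke operators match under `coeffRepIsoOfEq` (both are `heckeFun`). [folklore] -/
theorem heckeRepHom_comp_coeffRepIsoOfEq_hom (h : ρ = ρ') (g : 𝒢) :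
    heckeRepHom ι L ρ g ≫ (coeffRepIsoOfEq ι L h).hom =
      (coeffRepIsoOfEq ι L h).hom ≫ heckeRepHom ι L ρ' g :=
  Rep.hom_ext (Representation.IntertwiningMap.ext (LinearMap.ext fun _ => rfl))

/-- On cohomology: `H^i(coeffRepIsoOfEq) ∘ T_g = T_g ∘ H^i(coeffRepIsoOfEq)`. [folklore] -/
theorem map_coeffRepIsoOfEq_heckeEnd (h : ρ = ρ') (g : 𝒢) (i : ℕ) (x : cohomology ι L ρ i) :
    (groupCohomology.map (MonoidHom.id Γ) (coeffRepIsoOfEq ι L h).hom i).hom (heckeEnd ι L ρ g i x) =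
      heckeEnd ι L ρ' g i ((groupCohomology.map (MonoidHom.id Γ) (coeffRepIsoOfEq ι L h).hom i).hom x) := by
  have hc := congrArg (fun f => (groupCohomology.map (MonoidHom.id Γ) f i).hom x)
    (heckeRepHom_comp_coeffRepIsoOfEq_hom ι L h g)
  simp only [groupCohomology.map_id_comp, ModuleCat.hom_comp, LinearMap.comp_apply] at hc
  exact hc

/-- The induced isomorphism `H^i(S_L, Ṽ_ρ) ≅ H^i(S_L, Ṽ_{ρ'})` on cohomology. [folklore] -/
def cohomologyIsoOfEq (h : ρ = ρ') (i : ℕ) : cohomology ι L ρ i ≅ cohomology ι L ρ' i :=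
  (groupCohomology.functor k Γ i).mapIso (coeffRepIsoOfEq ι L h)

/-- `cohomologyIsoOfEq` is the functoriality map of `coeffRepIsoOfEq`. [folklore] -/
theorem cohomologyIsoOfEq_hom (h : ρ = ρ') (i : ℕ) :
    (cohomologyIsoOfEq ι L h i).hom = groupCohomology.map (MonoidHom.id Γ) (coeffRepIsoOfEq ι L h).hom i :=
  rfl

/-- Hecke-equivariance of `cohomologyIsoOfEq`. [folklore] -/
theorem cohomologyIsoOfEq_hom_heckeEnd (h : ρ = ρ') (g : 𝒢) (i : ℕ) (x : cohomology ι L ρ i) :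
    (cohomologyIsoOfEq ι L h i).hom.hom (heckeEnd ι L ρ g i x) =
      heckeEnd ι L ρ' g i ((cohomologyIsoOfEq ι L h i).hom.hom x) :=
  map_coeffRepIsoOfEq_heckeEnd ι L h g i x

end TwistedQuotient

/-! ### `⨂_τ V_wt(E)` as a representation of `GL_n(𝔸_F^∞)` -/

namespace ParallelWeight

open BigHeckeGLn

variable (E : Type) [Field E] (F : Type) [Field F] [NumberField F] (n : ℕ) (wt : Fin n → ℤ)
  (v : (F →+* E) → HeightOneSpectrum (𝓞 F))
  (φ : ∀ τ : F →+* E, (v τ).adicCompletion F →+* E)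

/-- **`⨂_τ V_wt(E)` as a representation of `GL_n(𝔸_F^∞)`** attached to place data `(v, φ)`:
`g ↦ ⨂_τ V_wt(GL_n(φ_τ)(g_{v(τ)}))` — the action of the finite-adelic group on the rational
coefficients through its components at the places `v(τ)` (above `p`, for `E = ℚ̄_p`), Hida's
"`(g, P) ↦ (g, g_p P)`". [cite: Hida1994AIF, §1] [cite: KhareThorne2017, §6.4 (M_𝛌 ⊗ E)] -/
def adelicCoeffRep : Representation E (FiniteAdelicGL n F) (CoeffModule E F n wt) :=
  show Representation E (FiniteAdelicGL n F) (⨂[E] _τ : (F →+* E), GLnCohomology.CoeffModule E n wt)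
    from PiTensorProduct.mapMonoidHom.comp
      (MonoidHom.pi fun τ : F →+* E =>
        (GLnCohomology.coeffRepGL E n wt).comp
          ((Matrix.GeneralLinearGroup.map (φ τ)).comp (localComponent n F (v τ))))

/-- Unfolding lemma on pure tensors: `σ(g)(⨂_τ x_τ) = ⨂_τ V_wt(GL_n(φ_τ) g_{v τ}) x_τ`. [folklore] -/
theorem adelicCoeffRep_apply_tprod (g : FiniteAdelicGL n F)
    (x : (F →+* E) → GLnCohomology.CoeffModule E n wt) :
    adelicCoeffRep E F n wt v φ g (PiTensorProduct.tprod E x) =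
      PiTensorProduct.tprod E fun τ =>
        GLnCohomology.coeffRepGL E n wt
          (Matrix.GeneralLinearGroup.map (φ τ) (localComponent n F (v τ) g)) (x τ) := by
  change PiTensorProduct.map _ _ = _
  exact PiTensorProduct.map_tprod _ _

/-- The action depends only on the components at the places `v τ`. [folklore] -/
theorem adelicCoeffRep_eq_of_localComponent_eq {g g' : FiniteAdelicGL n F}
    (h : ∀ τ, localComponent n F (v τ) g = localComponent n F (v τ) g') :
    adelicCoeffRep E F n wt v φ g = adelicCoeffRep E F n wt v φ g' := by
  change PiTensorProduct.map _ = PiTensorProduct.map _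
  congr 1
  funext τ
  change GLnCohomology.coeffRepGL E n wt (Matrix.GeneralLinearGroup.map (φ τ) (localComponent n F (v τ) g)) =
    GLnCohomology.coeffRepGL E n wt (Matrix.GeneralLinearGroup.map (φ τ) (localComponent n F (v τ) g'))
  rw [h τ]

variable {E F n v φ} in
/-- `GL_n(φ_τ)` of the `v(τ)`-component of a principal element `γ` is `GL_n(τ)(γ)` when
`φ_τ ∘ (F → F_{v τ}) = τ`. [folklore] -/
theorem map_localComponent_globalEmbedding
    (hφ : ∀ (τ : F →+* E) (x : F), φ τ (algebraMap F ((v τ).adicCompletion F) x) = τ x)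
    (τ : F →+* E) (γ : GL (Fin n) F) :
    Matrix.GeneralLinearGroup.map (φ τ) (localComponent n F (v τ) (globalEmbedding n F γ)) =
      Matrix.GeneralLinearGroup.map τ γ := by
  -- the `v`-component of a principal element is the matrix mapped along `F → F_v` (definitionally,
  -- cf. `localComponent_globalEmbedding` of `BorelGoodPlaceModel`)
  refine Matrix.GeneralLinearGroup.ext fun i j => ?_
  exact hφ τ (γ i j)

/-- **`adelicCoeffRep` restricts to `ParallelWeight.coeffRep` on `GL_n(F)`** (for place data with
`φ_τ ∘ (F → F_{v τ}) = τ`): the finite-adelic action extends the rational one.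
[cite: Hida1994AIF, §1] -/
theorem adelicCoeffRep_comp_globalEmbedding
    (hφ : ∀ (τ : F →+* E) (x : F), φ τ (algebraMap F ((v τ).adicCompletion F) x) = τ x) :
    (adelicCoeffRep E F n wt v φ).comp (globalEmbedding n F) = coeffRep E F n wt := by
  refine MonoidHom.ext fun γ => ?_
  change PiTensorProduct.map _ = PiTensorProduct.map _
  congr 1
  funext τ
  change GLnCohomology.coeffRepGL E n wt
      (Matrix.GeneralLinearGroup.map (φ τ) (localComponent n F (v τ) (globalEmbedding n F γ))) =
    GLnCohomology.coeffRepGL E n wt (Matrix.GeneralLinearGroup.map τ γ)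
  rw [map_localComponent_globalEmbedding hφ τ γ]

/-- Pointwise form: `σ(ι γ) = coeffRep γ`. [folklore] -/
theorem adelicCoeffRep_globalEmbedding
    (hφ : ∀ (τ : F →+* E) (x : F), φ τ (algebraMap F ((v τ).adicCompletion F) x) = τ x)
    (γ : GL (Fin n) F) :
    adelicCoeffRep E F n wt v φ (globalEmbedding n F γ) = coeffRep E F n wt γ := by
  rw [← adelicCoeffRep_comp_globalEmbedding E F n wt v φ hφ, MonoidHom.comp_apply]

/-! ### Place data over `ℚ̄_p` -/

variable (p : ℕ) [Fact p.Prime]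

/-- **Place data over `ℚ̄_p` exist**: every `τ : F → ℚ̄_p` cuts out a place `v(τ)` above `p`
(`|τ r| < 1 ↔ r ∈ v(τ)`) and extends to a CONTINUOUS `φ_τ : F_{v(τ)} → ℚ̄_p` with
`φ_τ ∘ (F → F_{v(τ)}) = τ`. [cite: NeukirchANT1999, Ch. II §8 (pp. 160–161)] -/
theorem exists_placeData_padicAlgCl :
    ∃ (v : (F →+* PadicAlgCl p) → HeightOneSpectrum (𝓞 F))
      (φ : ∀ τ : F →+* PadicAlgCl p, (v τ).adicCompletion F →+* PadicAlgCl p),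
      (∀ τ, ((p : ℕ) : 𝓞 F) ∈ (v τ).asIdeal) ∧
      (∀ (τ : F →+* PadicAlgCl p) (r : 𝓞 F), Valued.v (τ r) < 1 ↔ r ∈ (v τ).asIdeal) ∧
      (∀ τ, Continuous (φ τ)) ∧
        ∀ (τ : F →+* PadicAlgCl p) (x : F), φ τ (algebraMap F ((v τ).adicCompletion F) x) = τ x := by
  have h := fun τ : F →+* PadicAlgCl p =>
    Literature.NumberTheory.EllipticCurves.exists_heightOneSpectrum_of_ringHom_padicAlgCl τ
  choose v hpv hjv using h
  have h2 := fun τ : F →+* PadicAlgCl p =>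
    Literature.NumberTheory.EllipticCurves.exists_continuous_ringHom_adicCompletion_padicAlgCl
      τ (v τ) (hpv τ) (hjv τ)
  choose φ hφc hφ using h2
  exact ⟨v, φ, hpv, hjv, hφc, hφ⟩

/-- **The `p`-adic place `v(τ) ∣ p` cut out by `τ : F → ℚ̄_p`** (a choice of the place data).
[cite: NeukirchANT1999, Ch. II §8 (p. 160)] -/
def padicPlace (τ : F →+* PadicAlgCl p) : HeightOneSpectrum (𝓞 F) :=
  (exists_placeData_padicAlgCl F p).choose τ

/-- **The continuous extension `φ_τ : F_{v(τ)} → ℚ̄_p` of `τ`** (a choice of the place data).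
[cite: NeukirchANT1999, Ch. II §8 (pp. 160–161)] -/
def padicPlaceHom (τ : F →+* PadicAlgCl p) : (padicPlace F p τ).adicCompletion F →+* PadicAlgCl p :=
  (exists_placeData_padicAlgCl F p).choose_spec.choose τ

/-- `p ∈ v(τ)`: the chosen place lies above `p`. [folklore] -/
theorem natCast_mem_padicPlace (τ : F →+* PadicAlgCl p) :
    ((p : ℕ) : 𝓞 F) ∈ (padicPlace F p τ).asIdeal :=
  (exists_placeData_padicAlgCl F p).choose_spec.choose_spec.1 τ

/-- `v(τ)` is the place cut out by `τ`: `|τ r| < 1 ↔ r ∈ v(τ)` for `r ∈ 𝓞 F`. [folklore] -/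
theorem valued_lt_one_iff_mem_padicPlace (τ : F →+* PadicAlgCl p) (r : 𝓞 F) :
    Valued.v (τ r) < 1 ↔ r ∈ (padicPlace F p τ).asIdeal :=
  (exists_placeData_padicAlgCl F p).choose_spec.choose_spec.2.1 τ r

/-- `φ_τ` is continuous. [folklore] -/
theorem continuous_padicPlaceHom (τ : F →+* PadicAlgCl p) : Continuous (padicPlaceHom F p τ) :=
  (exists_placeData_padicAlgCl F p).choose_spec.choose_spec.2.2.1 τ

/-- `φ_τ` extends `τ`: `φ_τ (x) = τ x` for `x ∈ F`. [folklore] -/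
theorem padicPlaceHom_algebraMap (τ : F →+* PadicAlgCl p) (x : F) :
    padicPlaceHom F p τ (algebraMap F ((padicPlace F p τ).adicCompletion F) x) = τ x :=
  (exists_placeData_padicAlgCl F p).choose_spec.choose_spec.2.2.2 τ x

/-- **`⨂_{τ : F → ℚ̄_p} V_wt(ℚ̄_p)` as a representation of `GL_n(𝔸_F^∞)`** through the `p`-adic
places, `g ↦ ⨂_τ V_wt(GL_n(φ_τ)(g_{v(τ)}))` — the extension to the finite-adelic group of the
coefficient representation `coeffRep ℚ̄_p F n wt` of `hidaControl_dominantOrdinaryPoint`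
(`padicCoeffRep_comp_globalEmbedding`). [cite: Hida1994AIF, §1] [cite: KhareThorne2017, §6.4] -/
def padicCoeffRep : Representation (PadicAlgCl p) (FiniteAdelicGL n F) (CoeffModule (PadicAlgCl p) F n wt) :=
  adelicCoeffRep (PadicAlgCl p) F n wt (padicPlace F p) (padicPlaceHom F p)

/-- **`padicCoeffRep ∘ ι = coeffRep`** on `GL_n(F)` (`ι = globalEmbedding`). [cite: Hida1994AIF, §1] -/
theorem padicCoeffRep_comp_globalEmbedding :
    (padicCoeffRep F n wt p).comp (globalEmbedding n F) = coeffRep (PadicAlgCl p) F n wt :=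
  adelicCoeffRep_comp_globalEmbedding _ F n wt _ _ (padicPlaceHom_algebraMap F p)

/-- Pointwise form: `padicCoeffRep (ι γ) = coeffRep γ`. [folklore] -/
theorem padicCoeffRep_globalEmbedding (γ : GL (Fin n) F) :
    padicCoeffRep F n wt p (globalEmbedding n F γ) = coeffRep (PadicAlgCl p) F n wt γ :=
  adelicCoeffRep_globalEmbedding _ F n wt _ _ (padicPlaceHom_algebraMap F p) γ

/-- `padicCoeffRep g` depends only on the components of `g` at the `p`-adic places `v(τ)`; in
particular elements trivial above `p` (e.g. `t_{w,j}`, `w ∤ p`) act trivially. [folklore] -/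
theorem padicCoeffRep_eq_of_localComponent_eq {g g' : FiniteAdelicGL n F}
    (h : ∀ τ, localComponent n F (padicPlace F p τ) g = localComponent n F (padicPlace F p τ) g') :
    padicCoeffRep F n wt p g = padicCoeffRep F n wt p g' :=
  adelicCoeffRep_eq_of_localComponent_eq _ F n wt _ _ h

/-- Elements with trivial components at all places above `p` act trivially. [folklore] -/
theorem padicCoeffRep_eq_one_of_localComponent_eq_one {g : FiniteAdelicGL n F}
    (h : ∀ w : HeightOneSpectrum (𝓞 F), ((p : ℕ) : 𝓞 F) ∈ w.asIdeal → localComponent n F w g = 1) :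
    padicCoeffRep F n wt p g = 1 := by
  rw [← map_one (padicCoeffRep F n wt p)]
  exact padicCoeffRep_eq_of_localComponent_eq F n wt p fun τ => by
    rw [h _ (natCast_mem_padicPlace F p τ), map_one]

/-- **`H^q(X_U, Ṽ_wt(ℚ̄_p))` of the fact is the twisted cohomology of `padicCoeffRep ∘ ι`**, by the
identity-on-functions isomorphism (`TwistedQuotient.cohomologyIsoOfEq` along
`padicCoeffRep_comp_globalEmbedding`), Hecke-equivariantly
(`TwistedQuotient.cohomologyIsoOfEq_hom_heckeEnd`). [folklore] -/
def cohomologyIsoPadic (U : Subgroup (FiniteAdelicGL n F)) (q : ℕ) :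
    TwistedQuotient.cohomology (globalEmbedding n F) U
        ((padicCoeffRep F n wt p).comp (globalEmbedding n F)) q ≅
      cohomology (PadicAlgCl p) F n wt U q :=
  TwistedQuotient.cohomologyIsoOfEq (globalEmbedding n F) U (padicCoeffRep_comp_globalEmbedding F n wt p) q

/-- Hecke-equivariance of `cohomologyIsoPadic`: `Φ (T_g x) = heckeOp … g (Φ x)`. [folklore] -/
theorem cohomologyIsoPadic_hom_heckeEnd (U : Subgroup (FiniteAdelicGL n F)) (q : ℕ)
    (g : FiniteAdelicGL n F)
    (x : TwistedQuotient.cohomology (globalEmbedding n F) U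
      ((padicCoeffRep F n wt p).comp (globalEmbedding n F)) q) :
    (cohomologyIsoPadic F n wt p U q).hom.hom
        (TwistedQuotient.heckeEnd (globalEmbedding n F) U
          ((padicCoeffRep F n wt p).comp (globalEmbedding n F)) g q x) =
      heckeOp (PadicAlgCl p) F n wt U q g ((cohomologyIsoPadic F n wt p U q).hom.hom x) :=
  TwistedQuotient.cohomologyIsoOfEq_hom_heckeEnd (globalEmbedding n F) U
    (padicCoeffRep_comp_globalEmbedding F n wt p) g q x

end ParallelWeight

end Literature.NumberTheory.Automorphic
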